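import Literature.NumberTheory.Rogawski1990.FinExplicitTransferFactorInertExponentStub    -- ★ p841303: integrality from `hint` (brings ★ p840918 FILE 1: `exists_nat_valued_eq_exp_neg`, trichotomy)
import Literature.NumberTheory.Automorphic.RankTwoEigenframeOfSplitCharpoly               -- ★ (E1): second root, distinct roots from separability
import Literature.NumberTheory.DiophantineGeometry.GenEllValuationMultiplicity           -- ★ `GenEll.valuation_le_one_of_isRoot` (roots of integral monic polynomials are integral)
import HarnessLib

/-!
# The type-(1) exponent stub of the inert unit fundamental lemma IN THE STUB FRAME: the two roots `α ≠ γ` of `χ_{g,w}`, the exponents `N₁, N₂, N`, and their trichotomy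
# (Flicker 1998, pp. 74–75, §6 Thm. 15 p. 95; Rogawski 1990, §4.9 p. 55)

Topic `NumberTheory/Rogawski1990`; namespace `Literature.NumberTheory.Rogawski1990`.  THEOREMS ONLY (no definition, no instance, no notation, no named fact, no `sorry`;
count-neutral).  Cell `pub/hodgecm-mathlib`, F0∕P3a road «D-N7-inert», line «N7nsCount» ED. 1.4 (`stub_countSplitClause`; architect A-p06 (g26) «=» 2026-09-01T05:2xZ):
the value-stub **`stub_splitExponents`** PAID — from the stub's `hsplit` (a root of `χ_{g,w}` in `L_w`), `hreg` (`G`-regularity: `χ_{ι(γ_H),w} = χ_{g,w}·(X − u_w)` separable)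
and `hint` (integrality), produce the two roots `α ≠ γ`, the exponents `N₁ = ord_w(α − u_w)`, `N₂ = ord_w(γ − u_w)`, `N = ord_w(α − γ)` and the THM-15 trichotomy
(**`exists_flicker_exponents_split`**), in the `IsRoot ((χ_g).map eval_w)` spelling of ★ B-p10 p841055 `stableOrbitalIntegralRel_indicator_eq_phiH_of_isRoot`.
HONEST LABEL: HC_CM is proved only modulo the printed citations until rung 0 closes.

THE MATHEMATICS.  `χ_{g,w}` is a monic quadratic over the field `L_w` with a root `α` (`hsplit`), so `χ_{g,w} = (X − α)(X − γ)` (★ `exists_eq_X_sub_C_mul_X_sub_C_of_isRoot`);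
`χ_{ι(γ_H),w} = χ_{g,w}·(X − b)`, `b = u_w` (★ `charpoly_map_endoEmbLocal_apply`) is separable (`hreg`), so `α, γ, b` are pairwise distinct (no repeated root); `α, γ` are
integral (roots of a monic polynomial with integral coefficients, `tr g_w, det g_w ∈ 𝒪_w` by ★ `valued_trace_le_one_and_valued_det_le_one_of_hint`) and `v_w(b) = 1`, so the
three differences are integral and non-zero: `v_w = exp(−N)` with `N : ℕ` (★ `exists_nat_valued_eq_exp_neg`), and ★ `flicker_exponents_trichotomy_of_roots` closes.

## References
* [Flicker1998UnitaryFL] Y. Z. Flicker, *Elementary proof of the fundamental lemma for a unitary group*, Canad. J. Math. 50 (1998), pp. 74–75, §6 Thm. 15 p. 95.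
* [Rogawski1990] J. D. Rogawski, *Automorphic Representations of Unitary Groups in Three Variables*, Ann. of Math. Stud. 123 (1990), §4.9 p. 55, Prop. 4.9.1 (b).
-/

set_option autoImplicit false

noncomputable section

open Matrix NumberField IsDedekindDomain Polynomial
open scoped MatrixGroups Valued

namespace Literature.NumberTheory.Rogawski1990

open Literature.NumberTheory.Automorphic Literature.NumberTheory.Automorphic.UnitaryGroup Literature.NumberTheory.GaloisRepresentations
open Literature.NumberTheory.DiophantineGeometry

variable (L : Type) [Field L] [NumberField L] [IsCMField L] (v : HeightOneSpectrum (𝓞 ↥(maximalRealSubfield L)))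
  (w : PlacesOver L v) (hw : IsCMField.complexConj L • w.1 = w.1)

omit [IsCMField L] in
/-- Three pairwise products: a separable `(X − α)(X − γ)(X − b)` has `α ≠ b` and `γ ≠ b` (Mathlib `nodup_roots`). [folklore] -/
private theorem ne_and_ne_of_separable_mul_three {α γ b : w.1.adicCompletion L}
    (hsep : ((X - C α) * (X - C γ) * (X - C b)).Separable) : α ≠ b ∧ γ ≠ b := by
  have hnd := Polynomial.nodup_roots hsep
  have h0 : (X - C α) * (X - C γ) * (X - C b) ≠ 0 :=
    mul_ne_zero (mul_ne_zero (X_sub_C_ne_zero α) (X_sub_C_ne_zero γ)) (X_sub_C_ne_zero b)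
  rw [Polynomial.roots_mul h0, Polynomial.roots_mul (mul_ne_zero (X_sub_C_ne_zero α) (X_sub_C_ne_zero γ)), Polynomial.roots_X_sub_C,
    Polynomial.roots_X_sub_C, Polynomial.roots_X_sub_C] at hnd
  have hnd' : Multiset.Nodup (α ::ₘ γ ::ₘ {b}) := by simpa using hnd
  rw [Multiset.nodup_cons, Multiset.nodup_cons] at hnd'
  obtain ⟨hα, hγ, -⟩ := hnd'
  refine ⟨fun h => hα ?_, fun h => hγ ?_⟩
  · rw [h]; simp
  · rw [h]; simp

omit [IsCMField L] in
/-- A root of a monic `p = X² − tX + d` with `t, d` integral is integral (★ `GenEll.valuation_le_one_of_isRoot`). [cite: Rogawski1990, §4.9 p. 55] -/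
private theorem valued_le_one_of_isRoot_quadratic {p : (w.1.adicCompletion L)[X]} (hp : p.Monic) {t d α : w.1.adicCompletion L}
    (hq : p = X ^ 2 - C t * X + C d) (ht : Valued.v t ≤ 1) (hd : Valued.v d ≤ 1) (hα : p.IsRoot α) : Valued.v α ≤ 1 := by
  refine GenEll.valuation_le_one_of_isRoot Valued.v (fun n => ?_) (by rw [hp.leadingCoeff, map_one]) hα
  rw [hq]
  simp only [coeff_add, coeff_sub, coeff_X_pow, coeff_C_mul, coeff_X, coeff_C]
  rcases n with _ | _ | _ | n
  · simpa using hd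
  · simpa using ht
  · simp
  · simp

set_option maxHeartbeats 400000 in
include hw in
/-- **THE TYPE-(1) EXPONENTS IN THE STUB FRAME** (`stub_splitExponents` of line «N7nsCount» ED. 1.4): for `γ_H` `G`-regular (`hreg`) with integral `χ_{ι_v(γ_H),w}` (`hint`) and
a root of `χ_{g,w}` in `L_w` (`hsplit`), there are the two roots `α ≠ γ` of `χ_{g,w}` and `N₁ N₂ N : ℕ` with `v_w(α − b) = exp(−N₁)`, `v_w(γ − b) = exp(−N₂)`,
`v_w(α − γ) = exp(−N)` (`b = u_w`) and the THM-15 trichotomy `(N₁ = N₂ ∧ N₁ ≤ N) ∨ (N₁ = N ∧ N₁ ≤ N₂) ∨ (N₂ = N ∧ N₂ ≤ N₁)` — roots in the spelling of ★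
`stableOrbitalIntegralRel_indicator_eq_phiH_of_isRoot`, exponents in the spelling of ★ `finExplicitDelta_eq_neg_absNorm_zpow_neg_add_mul_kappa`.
[cite: Flicker1998UnitaryFL, pp. 74–75; §6 Thm. 15 p. 95] [cite: Rogawski1990, §4.9 p. 55, Prop. 4.9.1 (b)] -/
theorem exists_flicker_exponents_split
    {γH : (cmDatum L 2 (Matrix.of fun i j : Fin 2 => if i.val + j.val + 1 = 2 then (1 : L) else 0)).Local v ×
      (cmDatum L 1 (Matrix.of fun i j : Fin 1 => if i.val + j.val + 1 = 1 then (1 : L) else 0)).Local v}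
    (hreg : IsLocalGRegular L v γH)
    (hint : ∀ i : ℕ, ((((endoEmbLocal L v γH).val : GL (Fin 3) (LocalRing L v)).val.map
        (Pi.evalRingHom (fun w' : PlacesOver L v => w'.1.adicCompletion L) w)).charpoly.coeff i) ∈ 𝒪[w.1.adicCompletion L])
    (hsplit : ∃ x : w.1.adicCompletion L, (((γH.1.val : GL (Fin 2) (LocalRing L v)).val.map
        (Pi.evalRingHom (fun w' : PlacesOver L v => w'.1.adicCompletion L) w)).charpoly).IsRoot x) :
    ∃ (α γ : w.1.adicCompletion L) (N₁ N₂ N : ℕ),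
      ((((γH.1.val : GL (Fin 2) (LocalRing L v)) : Matrix (Fin 2) (Fin 2) (LocalRing L v)).charpoly).map
        (Pi.evalRingHom (fun w' : PlacesOver L v => w'.1.adicCompletion L) w)).IsRoot α ∧
      ((((γH.1.val : GL (Fin 2) (LocalRing L v)) : Matrix (Fin 2) (Fin 2) (LocalRing L v)).charpoly).map
        (Pi.evalRingHom (fun w' : PlacesOver L v => w'.1.adicCompletion L) w)).IsRoot γ ∧
      α ≠ γ ∧
      Valued.v (α - finGammaTwo L v γH w) = WithZero.exp (-(N₁ : ℤ)) ∧
      Valued.v (γ - finGammaTwo L v γH w) = WithZero.exp (-(N₂ : ℤ)) ∧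
      Valued.v (α - γ) = WithZero.exp (-(N : ℤ)) ∧
      ((N₁ = N₂ ∧ N₁ ≤ N) ∨ (N₁ = N ∧ N₁ ≤ N₂) ∨ (N₂ = N ∧ N₂ ≤ N₁)) := by
  obtain ⟨γ₂, γ₁⟩ := γH
  obtain ⟨α, hα⟩ := hsplit
  have hcm : (((γ₂.val : GL (Fin 2) (LocalRing L v)).val.map (Pi.evalRingHom (fun w' : PlacesOver L v => w'.1.adicCompletion L) w)).charpoly) =
      (((γ₂.val : GL (Fin 2) (LocalRing L v)) : Matrix (Fin 2) (Fin 2) (LocalRing L v)).charpoly).map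
        (Pi.evalRingHom (fun w' : PlacesOver L v => w'.1.adicCompletion L) w) := Matrix.charpoly_map _ _
  rw [hcm] at hα
  -- the monic quadratic `χ_{g,w}` and its second root
  have hmonic : ((((γ₂.val : GL (Fin 2) (LocalRing L v)) : Matrix (Fin 2) (Fin 2) (LocalRing L v)).charpoly).map
      (Pi.evalRingHom (fun w' : PlacesOver L v => w'.1.adicCompletion L) w)).Monic := (Matrix.charpoly_monic _).map _
  have hdeg : ((((γ₂.val : GL (Fin 2) (LocalRing L v)) : Matrix (Fin 2) (Fin 2) (LocalRing L v)).charpoly).map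
      (Pi.evalRingHom (fun w' : PlacesOver L v => w'.1.adicCompletion L) w)).natDegree = 2 := by
    rw [(Matrix.charpoly_monic _).natDegree_map, Matrix.charpoly_natDegree_eq_dim, Fintype.card_fin]
  obtain ⟨γ, hfac⟩ := exists_eq_X_sub_C_mul_X_sub_C_of_isRoot hmonic hdeg hα
  have hγ : ((((γ₂.val : GL (Fin 2) (LocalRing L v)) : Matrix (Fin 2) (Fin 2) (LocalRing L v)).charpoly).map
      (Pi.evalRingHom (fun w' : PlacesOver L v => w'.1.adicCompletion L) w)).IsRoot γ := by
    rw [hfac]; simp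
  -- `G`-regularity: `χ_{ι(γ_H),w} = (X − α)(X − γ)(X − b)` separable
  have h3 : IsRegularElt ((endoEmbLocal L v (γ₂, γ₁)).val : GL (Fin 3) (LocalRing L v)) := hreg
  have hsep3 : ((X - C α) * (X - C γ) * (X - C (finGammaTwo L v (γ₂, γ₁) w))).Separable := by
    have h3' : (((endoEmbLocal L v (γ₂, γ₁)).val : GL (Fin 3) (LocalRing L v)).val.charpoly).Separable := h3
    have h := Polynomial.Separable.map (f := Pi.evalRingHom (fun w' : PlacesOver L v => w'.1.adicCompletion L) w) h3'
    rw [← Matrix.charpoly_map, charpoly_map_endoEmbLocal_apply L (w := w) (γH := (γ₂, γ₁)), hcm, hfac] at h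
    exact h
  obtain ⟨hαb, hγb⟩ := ne_and_ne_of_separable_mul_three L v w hsep3
  have hαγ : α ≠ γ := ne_of_eq_X_sub_C_mul_X_sub_C_of_separable (p := (X - C α) * (X - C γ)) rfl (Polynomial.Separable.of_mul_left hsep3)
  -- integrality
  obtain ⟨htr, hdet⟩ := valued_trace_le_one_and_valued_det_le_one_of_hint L v w hw (γ₂, γ₁) hint
  have hquad : (((γ₂.val : GL (Fin 2) (LocalRing L v)) : Matrix (Fin 2) (Fin 2) (LocalRing L v)).charpoly).map
      (Pi.evalRingHom (fun w' : PlacesOver L v => w'.1.adicCompletion L) w) =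
      X ^ 2 - C ((γ₂.val : GL (Fin 2) (LocalRing L v)).val.map (Pi.evalRingHom (fun w' : PlacesOver L v => w'.1.adicCompletion L) w)).trace * X + C ((γ₂.val : GL (Fin 2) (LocalRing L v)).val.map (Pi.evalRingHom (fun w' : PlacesOver L v => w'.1.adicCompletion L) w)).det := by
    rw [← hcm, Matrix.charpoly_fin_two]
  have hαint : Valued.v α ≤ 1 := valued_le_one_of_isRoot_quadratic L v w hmonic hquad htr hdet hα
  have hγint : Valued.v γ ≤ 1 := valued_le_one_of_isRoot_quadratic L v w hmonic hquad htr hdet hγ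
  have hb : Valued.v (finGammaTwo L v (γ₂, γ₁) w) = 1 := valued_finGammaTwo_apply_eq_one L v (γ₂, γ₁) w hw
  -- the exponents
  have hle : ∀ {x y : w.1.adicCompletion L}, Valued.v x ≤ 1 → Valued.v y ≤ 1 → Valued.v (x - y) ≤ 1 :=
    fun hx hy => (Valuation.map_sub _ _ _).trans (max_le hx hy)
  obtain ⟨N₁, hN₁⟩ := exists_nat_valued_eq_exp_neg L v w (sub_ne_zero.2 hαb) (hle hαint hb.le)
  obtain ⟨N₂, hN₂⟩ := exists_nat_valued_eq_exp_neg L v w (sub_ne_zero.2 hγb) (hle hγint hb.le)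
  obtain ⟨N, hN⟩ := exists_nat_valued_eq_exp_neg L v w (sub_ne_zero.2 hαγ) (hle hαint hγint)
  exact ⟨α, γ, N₁, N₂, N, hα, hγ, hαγ, hN₁, hN₂, hN, flicker_exponents_trichotomy_of_roots L v w (γ₂, γ₁) hN₁ hN₂ hN⟩

end Literature.NumberTheory.Rogawski1990

end
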